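import Mathlib
import Literature.Computability.AlgebraicComplexity.SimultaneousDoubleProduct

/-!
# Packing inequalities of a clustered SDPP family — stub `stub_leafPacking` of line
`registered` (crux `EisensteinValCertificates.HomocyclicSTPPDesigns`, stmt-MatrixMultiplication-10647)

The clustered-charts line asks (its open leaf) for SDPP families `(A_i, B_i)_{i<n}` in `ℤ/p`
(tree `IsSDPP`, Cohn–Kleinberg–Szegedy–Umans 2005, §4 Def. 4.1) with uniform sizes `|A_i| = a`,
`|B_i| = b`, a class map `cls : Fin n → Fin m` whose classes have pairwise DISJOINT diagonal
difference sets `D_i = A_i − B_i` across classes, and every class of size `≥ d`.  This file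
collects the elementary PACKING inequalities such a family satisfies (kill-side calibration; a
neighbouring stub compares them with `PrimeCyclicPowerGain`):

* `n·a ≤ p`, `n·b ≤ p`: the `A_i` (resp. `B_i`) are pairwise disjoint (CKSU, proof of Prop. 4.6;
  tree `IsSDPP.sum_card_left_le` / `sum_card_right_le`);
* `m·(ab) ≤ p`: one difference set per class, each of size `ab` because clause (W) makes
  `(x, y) ↦ x − y` injective on `A_i × B_i`, pairwise disjoint by the clustering hypothesis;
* `m·d ≤ n`: the classes partition the index set;
* `(n−1)·a + m·(ab) ≤ p`: for a fixed index `k` and `b₀ ∈ B_k` the translate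
  `(⋃_{i≠k} A_i) − b₀` (of size `(n−1)·a`) misses EVERY `A_j − B_j`, since
  `a_i − b₀ = a'_j − b_j` reads `(a_i − a'_j) + (b_j − b₀) = 0` and clause (X) forces `i = k`;
* `(n−1)·b + m·(ab) ≤ p`: symmetrically with `a₀ − ⋃_{i≠k} B_i` and clause (X) at `(k, j, i)`.

Everything is proved over an arbitrary finite additive abelian group `H` (`leafPacking_general`,
with `Fintype.card H` in place of `p`) and then specialised to `H = ZMod p` through `ZMod.card`.

Sources: H. Cohn, R. Kleinberg, B. Szegedy, C. Umans, *Group-theoretic algorithms for matrix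
multiplication*, FOCS 2005, §4 Def. 4.1 and the proof of Prop. 4.6 (disjointness of the `A_i`,
of the `B_i`, and injectivity of the quotient map on `A_i × B_i`).  Not here: the leaf itself, the
swap symmetry, or the comparison with `PrimeCyclicPowerGain` — those are other stubs of the line.
-/

set_option linter.dupNamespace false
-- (single-conjunct summit: the namespace repeats `MatrixMultiplication`)

namespace Summit.MatrixMultiplication.MatrixMultiplication.Theorems.HomocyclicSTPPDesigns.ClusteredCharts

open Literature.Computability.AlgebraicComplexity Finset
open scoped Pointwise

section General

variable {H : Type*} [AddCommGroup H] [DecidableEq H] {n : ℕ} {A B : Fin n → Finset H}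

/-- Clause (W) of the SDPP makes `(x, y) ↦ x - y` injective on `A i ×ˢ B i`, so the diagonal
difference set `A i - B i` has exactly `|A i| · |B i|` elements (Cohn–Kleinberg–Szegedy–Umans 2005,
proof of Prop. 4.6, additive form). [cite: CohnKleinbergSzegedyUmans2005, Prop. 4.6 (proof)] -/
theorem leafPacking_card_sub (hS : IsSDPP A B) (i : Fin n) :
    (A i - B i).card = (A i).card * (B i).card := by
  refine le_antisymm Finset.card_sub_le ?_
  rw [← Finset.card_product]
  refine Finset.card_le_card_of_injOn (fun q => q.1 - q.2) (fun q hq => ?_) ?_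
  · rw [Finset.mem_coe, Finset.mem_product] at hq
    exact Finset.sub_mem_sub hq.1 hq.2
  · intro q hq q' hq' hqq'
    rw [Finset.mem_coe, Finset.mem_product] at hq hq'
    have he : q.1 - q.2 = q'.1 - q'.2 := hqq'
    have h0 : (q.1 - q'.1) + (q'.2 - q.2) = 0 := by
      have : (q.1 - q'.1) + (q'.2 - q.2) = (q.1 - q.2) - (q'.1 - q'.2) := by abel
      rw [this, he, sub_self]
    obtain ⟨h1, h2⟩ := hS.dpp i hq.1 hq'.1 hq'.2 hq.2 h0
    exact Prod.ext h1 h2.symm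

/-- For a fixed index `k` and `b₀ ∈ B k`, the translate `(⋃_{i ≠ k} A i) - b₀` is disjoint from
every diagonal difference set `A j - B j`: a coincidence `x - b₀ = a' - b'` with `x ∈ A i`,
`a' ∈ A j`, `b' ∈ B j` reads `(x - a') + (b' - b₀) = 0`, and clause (X) of the SDPP forces `i = k`.
[cite: CohnKleinbergSzegedyUmans2005, §4 Def. 4.1] -/
theorem leafPacking_disjoint_translate_left (hS : IsSDPP A B) (k : Fin n) {b₀ : H}
    (hb₀ : b₀ ∈ B k) (j : Fin n) :
    Disjoint (((Finset.univ.erase k).biUnion A).image fun x => x - b₀) (A j - B j) := by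
  rw [Finset.disjoint_left]
  intro z hz hz'
  rw [Finset.mem_image] at hz
  obtain ⟨x, hx, rfl⟩ := hz
  rw [Finset.mem_biUnion] at hx
  obtain ⟨i, hi, hxi⟩ := hx
  rw [Finset.mem_erase] at hi
  rw [Finset.mem_sub] at hz'
  obtain ⟨a', ha', b', hb', he⟩ := hz'
  refine hi.1 (hS.simultaneous hxi ha' hb' hb₀ ?_)
  have : (x - a') + (b' - b₀) = (x - b₀) - (a' - b') := by abel
  rw [this, he, sub_self]

/-- For a fixed index `k` and `a₀ ∈ A k`, the reflected translate `a₀ - ⋃_{i ≠ k} B i` is disjoint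
from every diagonal difference set `A j - B j`: a coincidence `a₀ - y = a' - b'` with `y ∈ B i`,
`a' ∈ A j`, `b' ∈ B j` reads `(a₀ - a') + (b' - y) = 0`, and clause (X) of the SDPP (at the index
triple `(k, j, i)`) forces `k = i`. [cite: CohnKleinbergSzegedyUmans2005, §4 Def. 4.1] -/
theorem leafPacking_disjoint_translate_right (hS : IsSDPP A B) (k : Fin n) {a₀ : H}
    (ha₀ : a₀ ∈ A k) (j : Fin n) :
    Disjoint (((Finset.univ.erase k).biUnion B).image fun y => a₀ - y) (A j - B j) := by
  rw [Finset.disjoint_left]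
  intro z hz hz'
  rw [Finset.mem_image] at hz
  obtain ⟨y, hy, rfl⟩ := hz
  rw [Finset.mem_biUnion] at hy
  obtain ⟨i, hi, hyi⟩ := hy
  rw [Finset.mem_erase] at hi
  rw [Finset.mem_sub] at hz'
  obtain ⟨a', ha', b', hb', he⟩ := hz'
  refine hi.1 (hS.simultaneous ha₀ ha' hb' hyi ?_).symm
  have : (a₀ - a') + (b' - y) = (a₀ - y) - (a' - b') := by abel
  rw [this, he, sub_self]

/-- With all `B i` non-empty the `A i` are pairwise disjoint (clause (X)), so for uniform
`|A i| = a` the translate `(⋃_{i ≠ k} A i) - b₀` has exactly `(n - 1) · a` elements.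
[cite: CohnKleinbergSzegedyUmans2005, Prop. 4.6 (proof)] -/
theorem leafPacking_card_translate_left (hS : IsSDPP A B) (hBne : ∀ i, (B i).Nonempty) {a : ℕ}
    (hA : ∀ i, (A i).card = a) (k : Fin n) (b₀ : H) :
    (((Finset.univ.erase k).biUnion A).image fun x => x - b₀).card = (n - 1) * a := by
  rw [Finset.card_image_of_injective _ sub_left_injective, Finset.card_biUnion]
  · rw [Finset.sum_congr rfl fun i _ => hA i, Finset.sum_const, smul_eq_mul,
      Finset.card_erase_of_mem (Finset.mem_univ k), Finset.card_univ, Fintype.card_fin]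
  · intro i _ j _ hij
    exact disjoint_left_of_simultaneous hS.2 hij (hBne j)

/-- With all `A i` non-empty the `B i` are pairwise disjoint (clause (X)), so for uniform
`|B i| = b` the reflected translate `a₀ - ⋃_{i ≠ k} B i` has exactly `(n - 1) · b` elements.
[cite: CohnKleinbergSzegedyUmans2005, Prop. 4.6 (proof)] -/
theorem leafPacking_card_translate_right (hS : IsSDPP A B) (hAne : ∀ i, (A i).Nonempty) {b : ℕ}
    (hB : ∀ i, (B i).card = b) (k : Fin n) (a₀ : H) :
    (((Finset.univ.erase k).biUnion B).image fun y => a₀ - y).card = (n - 1) * b := by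
  rw [Finset.card_image_of_injective _ sub_right_injective, Finset.card_biUnion]
  · rw [Finset.sum_congr rfl fun i _ => hB i, Finset.sum_const, smul_eq_mul,
      Finset.card_erase_of_mem (Finset.mem_univ k), Finset.card_univ, Fintype.card_fin]
  · intro i _ j _ hij
    exact disjoint_right_of_simultaneous hS.2 hij (hAne i)

/-- **Packing inequalities of a clustered SDPP family, general form**: in a finite additive abelian
group `H`, an SDPP family `(A i, B i)_{i<n}` with `|A i| = a ≥ 1`, `|B i| = b ≥ 1`, a class map
`cls : Fin n → Fin m` with cross-class disjoint difference sets `A i - B i` and classes of size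
`≥ d ≥ 1` satisfies `n·a ≤ |H|`, `n·b ≤ |H|`, `m·(ab) ≤ |H|`, `m·d ≤ n`,
`(n−1)·a + m·(ab) ≤ |H|` and `(n−1)·b + m·(ab) ≤ |H|`.
[cite: CohnKleinbergSzegedyUmans2005, Prop. 4.6 (proof)] -/
theorem leafPacking_general [Fintype H] {m a b d : ℕ} (cls : Fin n → Fin m) (hS : IsSDPP A B)
    (ha : 1 ≤ a) (hb : 1 ≤ b) (hcard : ∀ i, (A i).card = a ∧ (B i).card = b)
    (hcl : ∀ i j, cls i ≠ cls j → Disjoint (A i - B i) (A j - B j)) (hd : 1 ≤ d)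
    (hcls : ∀ c : Fin m, d ≤ (Finset.univ.filter fun i => cls i = c).card) :
    n * a ≤ Fintype.card H ∧ n * b ≤ Fintype.card H ∧ m * (a * b) ≤ Fintype.card H ∧
      m * d ≤ n ∧ (n - 1) * a + m * (a * b) ≤ Fintype.card H ∧
      (n - 1) * b + m * (a * b) ≤ Fintype.card H := by
  have hA : ∀ i, (A i).card = a := fun i => (hcard i).1
  have hB : ∀ i, (B i).card = b := fun i => (hcard i).2
  have hAne : ∀ i, (A i).Nonempty := fun i => Finset.card_pos.1 (by rw [hA i]; exact ha)
  have hBne : ∀ i, (B i).Nonempty := fun i => Finset.card_pos.1 (by rw [hB i]; exact hb)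
  -- (1) `n·a ≤ |H|` and (2) `n·b ≤ |H|`: pairwise disjointness of the `A i`, resp. the `B i`.
  have h1 : n * a ≤ Fintype.card H := by
    have h := hS.sum_card_left_le hBne
    rw [Finset.sum_congr rfl fun i _ => hA i, Fin.sum_const, smul_eq_mul] at h
    exact h
  have h2 : n * b ≤ Fintype.card H := by
    have h := hS.sum_card_right_le hAne
    rw [Finset.sum_congr rfl fun i _ => hB i, Fin.sum_const, smul_eq_mul] at h
    exact h
  -- one representative `t c` per class `c`
  have hrep : ∀ c : Fin m, ∃ i, cls i = c := by
    intro c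
    have hpos : 0 < (Finset.univ.filter fun i => cls i = c).card :=
      lt_of_lt_of_le (Nat.lt_of_succ_le hd) (hcls c)
    obtain ⟨i, hi⟩ := Finset.card_pos.1 hpos
    rw [Finset.mem_filter] at hi
    exact ⟨i, hi.2⟩
  choose t ht using hrep
  -- the union `U` of the representative difference sets has `m·(ab)` elements
  have hdisjD : (↑(Finset.univ : Finset (Fin m)) : Set (Fin m)).PairwiseDisjoint
      fun c => A (t c) - B (t c) := by
    intro c _ c' _ hcc'
    exact hcl (t c) (t c') (by rw [ht c, ht c']; exact hcc')
  have hDc : ∀ c, (A (t c) - B (t c)).card = a * b := fun c => by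
    rw [leafPacking_card_sub hS (t c), hA, hB]
  have hU : (Finset.univ.biUnion fun c => A (t c) - B (t c)).card = m * (a * b) := by
    rw [Finset.card_biUnion hdisjD, Finset.sum_congr rfl fun c _ => hDc c, Fin.sum_const,
      smul_eq_mul]
  -- (3) `m·(ab) ≤ |H|`
  have h3 : m * (a * b) ≤ Fintype.card H := by
    rw [← hU]
    exact Finset.card_le_univ _
  -- (4) `m·d ≤ n`: the classes partition `Fin n`
  have h4 : m * d ≤ n := by
    have hsum : (Finset.univ : Finset (Fin n)).card =
        ∑ c : Fin m, (Finset.univ.filter fun i => cls i = c).card :=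
      Finset.card_eq_sum_card_fiberwise fun i _ => Finset.mem_univ (cls i)
    have h := Finset.card_nsmul_le_sum (Finset.univ : Finset (Fin m))
      (fun c => (Finset.univ.filter fun i => cls i = c).card) d fun c _ => hcls c
    rw [← hsum, Finset.card_univ, Finset.card_univ, Fintype.card_fin, Fintype.card_fin,
      smul_eq_mul] at h
    exact h
  refine ⟨h1, h2, h3, h4, ?_⟩
  rcases Nat.eq_zero_or_pos n with hn | hn
  · -- `n = 0`: the refined packings reduce to (3)
    subst hn
    rw [Nat.zero_sub, zero_mul, zero_add, zero_mul, zero_add]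
    exact ⟨h3, h3⟩
  -- `n ≥ 1`: fix the index `k = 0`
  set k : Fin n := ⟨0, hn⟩ with hk
  constructor
  · -- (5) `(n−1)·a + m·(ab) ≤ |H|`
    obtain ⟨b₀, hb₀⟩ := hBne k
    have hTU : Disjoint (((Finset.univ.erase k).biUnion A).image fun x => x - b₀)
        (Finset.univ.biUnion fun c => A (t c) - B (t c)) := by
      rw [Finset.disjoint_biUnion_right]
      intro c _
      exact leafPacking_disjoint_translate_left hS k hb₀ (t c)
    have h := Finset.card_le_univ ((((Finset.univ.erase k).biUnion A).image fun x => x - b₀) ∪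
      Finset.univ.biUnion fun c => A (t c) - B (t c))
    rw [Finset.card_union_of_disjoint hTU, leafPacking_card_translate_left hS hBne hA k b₀,
      hU] at h
    exact h
  · -- (6) `(n−1)·b + m·(ab) ≤ |H|`
    obtain ⟨a₀, ha₀⟩ := hAne k
    have hTU : Disjoint (((Finset.univ.erase k).biUnion B).image fun y => a₀ - y)
        (Finset.univ.biUnion fun c => A (t c) - B (t c)) := by
      rw [Finset.disjoint_biUnion_right]
      intro c _
      exact leafPacking_disjoint_translate_right hS k ha₀ (t c)
    have h := Finset.card_le_univ ((((Finset.univ.erase k).biUnion B).image fun y => a₀ - y) ∪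
      Finset.univ.biUnion fun c => A (t c) - B (t c))
    rw [Finset.card_union_of_disjoint hTU, leafPacking_card_translate_right hS hAne hB k a₀,
      hU] at h
    exact h

end General

/-- **Packing inequalities of a clustered SDPP family** (registered stub `stub_leafPacking` of line
`registered`): for a prime `p`, an SDPP family `(A_i, B_i)_{i<n}` in `ℤ/p` (tree `IsSDPP`) with
`|A_i| = a ≥ 1`, `|B_i| = b ≥ 1`, a class map `cls : Fin n → Fin m` with cross-class disjoint
difference sets `A_i − B_i` and every class of size `≥ d ≥ 1` satisfies
`n·a ≤ p`, `n·b ≤ p`, `m·(ab) ≤ p`, `m·d ≤ n`, `(n−1)·a + m·(ab) ≤ p` and `(n−1)·b + m·(ab) ≤ p`.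
The `A_i` (resp. `B_i`) are pairwise disjoint and `(a, b) ↦ a − b` is injective on `A_i × B_i`
(Cohn–Kleinberg–Szegedy–Umans 2005, proof of Prop. 4.6); the refined packings add the translate
`(⋃_{i≠k} A_i) − b₀`, resp. `a₀ − ⋃_{i≠k} B_i`, which misses every `A_j − B_j` by clause (X).
[cite: CohnKleinbergSzegedyUmans2005, Prop. 4.6 (proof)] -/
theorem stub_leafPacking :
    ∀ (p n m a b d : ℕ), p.Prime → ∀ (A B : Fin n → Finset (ZMod p)) (cls : Fin n → Fin m),
      IsSDPP A B → 1 ≤ a → 1 ≤ b → (∀ i, (A i).card = a ∧ (B i).card = b) →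
      (∀ i j, cls i ≠ cls j → Disjoint (A i - B i) (A j - B j)) →
      1 ≤ d → (∀ c : Fin m, d ≤ (Finset.univ.filter fun i => cls i = c).card) →
      n * a ≤ p ∧ n * b ≤ p ∧ m * (a * b) ≤ p ∧ m * d ≤ n ∧
      (n - 1) * a + m * (a * b) ≤ p ∧ (n - 1) * b + m * (a * b) ≤ p := by
  intro p n m a b d hp A B cls hS ha hb hcard hcl hd hcls
  haveI : NeZero p := ⟨hp.ne_zero⟩
  have h := leafPacking_general cls hS ha hb hcard hcl hd hcls
  rw [ZMod.card p] at h
  exact h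

end Summit.MatrixMultiplication.MatrixMultiplication.Theorems.HomocyclicSTPPDesigns.ClusteredCharts
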